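import Mathlib.Combinatorics.SimpleGraph.Coloring.Vertex
import Mathlib.Algebra.Order.BigOperators.Group.Finset
import Mathlib.Algebra.BigOperators.Ring.Finset
import Mathlib.Data.Rat.Cast.Order
import Mathlib.Tactic
import HarnessLib

/-!
# The averaging lemma behind the LP route: a geometric-fractional (MRVZ) dual certificate plus a Følner datum excludes `k`-colourings
(cell `pub-namedobj`, target (U), seat udg g24 — landing pad for FARM-ASK-U24 #1)

Framing (verbatim for the cell): lottery ticket; floor = certified bounds/negative ranges.

THEORY-U21 §7 / THEORY-U24 §0: if a finite configuration `G ⊂ K²` has geometric fractional chromatic number `χ_gf(G) > 4` (the LP of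
Matolcsi–Ruzsa–Varga–Zsámboki, arXiv:2311.10069), then the unit-distance graph of `K²` is not 4-colourable; the published argument averages a
colouring over a Følner sequence of the (solvable, hence amenable) group generated by the congruences.  This file proves the FINITE COMBINATORIAL
CORE of that argument, in a form a certificate can instantiate, for an arbitrary graph `H` on a type `V`:

* the configuration is `p : Fin n → V`; a family `Φ : Fin N → (V → V)` of adjacency-preserving self-maps of `H` plays the Følner set;
* the dual certificate is `y : Fin n → ℚ`, `μ`, shapes `shape : Fin m → Finset (Fin n)` (nonempty) with weights `z`, grouped into classes by
  `rep : Fin m → Fin m`, with (dual feasibility) `Σ_{v∈S} y v + Σ_{t : shape t ⊆ S} z t ≤ μ` for every `S` independent in `H ∘ p`, and (balance)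
  `Σ_{t : rep t = r} z t = 0` for every `r`;
* the Følner/transport datum: for every shape `t`, a map `σ t : Fin N → Fin N`, injective off an exceptional set `E t` of size `≤ e`, such that for
  `i ∉ E t` the point set `Φ i (p (shape t))` equals `Φ (σ t i) (p (shape (rep t)))`;
* the margin `e · Σ_t |z t| < N · (Σ_v y v − k μ)`.

Conclusion (`not_colorable_of_geometric_certificate`): `H` is not `k`-colourable.  Proof: for a proper colouring `C` and each `i`, the `k` colour
classes of `C ∘ Φ i ∘ p` are independent, so dual feasibility summed over the classes gives `Σ_v y v + Σ_t z t·[shape t monochromatic under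
C ∘ Φ i ∘ p] ≤ k μ`; summing over `i` and writing `cnt t` for the number of `i` making shape `t` monochromatic, `Σ_t z t · cnt t ≤ N (k μ − Σ y)`;
transport gives `|cnt t − cnt (rep t)| ≤ e`, balance kills `Σ_t z t · cnt (rep t)`, and the margin is contradicted.  Pure finite combinatorics over
`ℚ`; the construction of the Følner datum for `K² ⋊ O₂(K)` (boxes in a lattice of translations × a box of rotations) is NOT in this file.
Ours (seat analysis); the averaging idea is MRVZ's Theorem 1; nothing here is a cited fact.
-/

namespace Summit.Ventures.DiscreteObjects.UnitDistance

open Finset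

/-- If `s` is nonempty, the number of values `κ` such that `f` is constantly `κ` on `s` is `1` when `f` is constant on `s` and `0` otherwise. -/
theorem card_filter_const_on {α β : Type*} [Fintype β] (s : Finset α) (hs : s.Nonempty) (f : α → β)
    [DecidablePred fun κ : β => ∀ v ∈ s, f v = κ] [Decidable (∃ κ, ∀ v ∈ s, f v = κ)] :
    ((univ : Finset β).filter fun κ => ∀ v ∈ s, f v = κ).card = if (∃ κ, ∀ v ∈ s, f v = κ) then 1 else 0 := by
  classical
  obtain ⟨a, ha⟩ := hs
  split_ifs with h
  · obtain ⟨κ, hκ⟩ := h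
    rw [Finset.card_eq_one]
    refine ⟨κ, ?_⟩
    ext x
    simp only [mem_filter, mem_univ, true_and, mem_singleton]
    constructor
    · intro hx; rw [← hx a ha, hκ a ha]
    · rintro rfl; exact hκ
  · rw [Finset.card_eq_zero, Finset.filter_eq_empty_iff]
    intro κ _ hκ
    exact h ⟨κ, hκ⟩

/-- THE AVERAGING LEMMA.  See the module docstring for the reading of the hypotheses. -/
theorem not_colorable_of_geometric_certificate
    {V : Type*} [DecidableEq V] {H : SimpleGraph V} {k n m N e : ℕ}
    (p : Fin n → V) (Φ : Fin N → V → V) (hΦ : ∀ i, ∀ ⦃a b : V⦄, H.Adj a b → H.Adj (Φ i a) (Φ i b))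
    (y : Fin n → ℚ) (μ : ℚ) (shape : Fin m → Finset (Fin n)) (hne : ∀ t, (shape t).Nonempty) (z : Fin m → ℚ)
    (rep : Fin m → Fin m)
    (hdual : ∀ S : Finset (Fin n), (∀ a ∈ S, ∀ b ∈ S, ¬ H.Adj (p a) (p b)) →
        ∑ v ∈ S, y v + ∑ t ∈ univ.filter (fun t => shape t ⊆ S), z t ≤ μ)
    (hbal : ∀ r : Fin m, ∑ t ∈ univ.filter (fun t => rep t = r), z t = 0)
    (σ : Fin m → Fin N → Fin N) (E : Fin m → Finset (Fin N)) (hE : ∀ t, (E t).card ≤ e)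
    (hσ : ∀ t, Set.InjOn (σ t) {i | i ∉ E t})
    (htrans : ∀ t i, i ∉ E t →
        (shape t).image (fun v => Φ i (p v)) = (shape (rep t)).image (fun v => Φ (σ t i) (p v)))
    (hmargin : (e : ℚ) * ∑ t, |z t| < (N : ℚ) * (∑ v, y v - (k : ℚ) * μ)) :
    ¬ H.Colorable k := by
  classical
  rintro ⟨C⟩
  -- monochromatic shapes and their counts
  let mono : Fin m → Fin N → Prop := fun t i => ∃ κ : Fin k, ∀ v ∈ shape t, C (Φ i (p v)) = κ
  let ind : Fin m → Fin N → ℚ := fun t i => if mono t i then 1 else 0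
  let cnt : Fin m → ℚ := fun t => ∑ i, ind t i
  -- STEP 1: for each i, Σ_v y v + Σ_t z t · ind t i ≤ k μ
  have step1 : ∀ i, ∑ v, y v + ∑ t, z t * ind t i ≤ (k : ℚ) * μ := by
    intro i
    -- colour classes
    let S : Fin k → Finset (Fin n) := fun κ => univ.filter fun v => C (Φ i (p v)) = κ
    have hS : ∀ κ, ∑ v ∈ S κ, y v + ∑ t ∈ univ.filter (fun t => shape t ⊆ S κ), z t ≤ μ := by
      intro κ
      apply hdual
      intro a ha b hb hab
      simp only [S, mem_filter, mem_univ, true_and] at ha hb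
      exact (C.valid (hΦ i hab)) (ha.trans hb.symm)
    have hsum := Finset.sum_le_sum fun κ (_ : κ ∈ (univ : Finset (Fin k))) => hS κ
    simp only [Finset.sum_add_distrib, Finset.sum_const, Finset.card_univ, Fintype.card_fin, nsmul_eq_mul] at hsum
    -- Σ_κ Σ_{v ∈ S κ} y v = Σ_v y v
    have hy : ∑ κ, ∑ v ∈ S κ, y v = ∑ v, y v := Finset.sum_fiberwise univ (fun v => C (Φ i (p v))) y
    -- Σ_κ Σ_{t : shape t ⊆ S κ} z t = Σ_t z t · ind t i
    have hz : ∑ κ, ∑ t ∈ univ.filter (fun t => shape t ⊆ S κ), z t = ∑ t, z t * ind t i := by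
      have h1 : ∀ κ, ∑ t ∈ univ.filter (fun t => shape t ⊆ S κ), z t = ∑ t, (if shape t ⊆ S κ then z t else 0) :=
        fun κ => Finset.sum_filter _ _
      rw [Finset.sum_congr rfl (fun κ _ => h1 κ), Finset.sum_comm]
      apply Finset.sum_congr rfl
      intro t _
      rw [← Finset.sum_filter, Finset.sum_const, nsmul_eq_mul, mul_comm]
      congr 1
      have hset : (univ.filter fun κ => shape t ⊆ S κ) = univ.filter fun κ => ∀ v ∈ shape t, C (Φ i (p v)) = κ := by
        ext κ; simp [S, Finset.subset_iff]
      rw [hset, card_filter_const_on _ (hne t)]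
      simp only [ind, mono]
      push_cast
      rfl
    linarith [hsum, hy, hz]
  -- STEP 2: sum over i
  have step2 : ∑ t, z t * cnt t ≤ (N : ℚ) * ((k : ℚ) * μ - ∑ v, y v) := by
    have h := Finset.sum_le_sum fun i (_ : i ∈ (univ : Finset (Fin N))) => step1 i
    simp only [Finset.sum_add_distrib, Finset.sum_const, Finset.card_univ, Fintype.card_fin, nsmul_eq_mul] at h
    have hswap : ∑ i, ∑ t, z t * ind t i = ∑ t, z t * cnt t := by
      rw [Finset.sum_comm]
      apply Finset.sum_congr rfl; intro t _
      rw [Finset.mul_sum]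
    linarith [h, hswap]
  -- STEP 3: transport, |cnt t - cnt (rep t)| ≤ e
  have ind_eq : ∀ t i, i ∉ E t → ind t i = ind (rep t) (σ t i) := by
    intro t i hi
    have key : mono t i ↔ mono (rep t) (σ t i) := by
      have himg := htrans t i hi
      constructor
      · rintro ⟨κ, hκ⟩
        refine ⟨κ, fun v hv => ?_⟩
        have hmem : Φ (σ t i) (p v) ∈ (shape (rep t)).image (fun v => Φ (σ t i) (p v)) := mem_image_of_mem _ hv
        rw [← himg] at hmem
        obtain ⟨w, hw, hw'⟩ := mem_image.1 hmem
        rw [← hw']; exact hκ w hw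
      · rintro ⟨κ, hκ⟩
        refine ⟨κ, fun v hv => ?_⟩
        have hmem : Φ i (p v) ∈ (shape t).image (fun v => Φ i (p v)) := mem_image_of_mem _ hv
        rw [himg] at hmem
        obtain ⟨w, hw, hw'⟩ := mem_image.1 hmem
        rw [← hw']; exact hκ w hw
    simp only [ind]
    by_cases h1 : mono t i
    · have h2 : mono (rep t) (σ t i) := key.1 h1
      rw [if_pos h1, if_pos h2]
    · have h2 : ¬ mono (rep t) (σ t i) := fun h => h1 (key.2 h)
      rw [if_neg h1, if_neg h2]
  have ind_nonneg : ∀ t i, 0 ≤ ind t i := by intro t i; simp only [ind]; split_ifs <;> norm_num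
  have ind_le_one : ∀ t i, ind t i ≤ 1 := by intro t i; simp only [ind]; split_ifs <;> norm_num
  have step3 : ∀ t, |cnt t - cnt (rep t)| ≤ e := by
    intro t
    -- split the sums over E t and its complement
    let G : Finset (Fin N) := univ.filter fun i => i ∉ E t
    have hsplit : ∀ f : Fin N → ℚ, ∑ i, f i = ∑ i ∈ E t, f i + ∑ i ∈ G, f i := by
      intro f
      rw [← Finset.sum_filter_add_sum_filter_not univ (fun i => i ∈ E t)]
      congr 1
      · congr 1; ext i; simp
    -- the complement part of cnt t equals a part of cnt (rep t) over the image of σ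
    have hG : ∑ i ∈ G, ind t i = ∑ j ∈ G.image (σ t), ind (rep t) j := by
      rw [Finset.sum_image]
      · apply Finset.sum_congr rfl; intro i hi
        simp only [G, mem_filter, mem_univ, true_and] at hi
        exact ind_eq t i hi
      · intro a ha b hb hab
        simp only [G, coe_filter, mem_univ, true_and] at ha hb
        exact hσ t ha hb hab
    have hcardG : (G.image (σ t)).card = G.card := Finset.card_image_of_injOn (by
      intro a ha b hb hab
      simp only [G, coe_filter, mem_univ, true_and] at ha hb
      exact hσ t ha hb hab)
    have hGc : G.card + (E t).card = N := by
      have := Finset.card_filter_add_card_filter_not (s := (univ : Finset (Fin N))) (fun i => i ∈ E t)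
      simp only [Finset.card_univ, Fintype.card_fin] at this
      have h1 : (univ.filter fun i => i ∈ E t) = E t := by ext i; simp
      rw [h1] at this
      simpa [G, add_comm] using this
    -- cnt (rep t) = part over image + part over complement of image
    have hsplit' : cnt (rep t) = ∑ j ∈ G.image (σ t), ind (rep t) j + ∑ j ∈ univ.filter (fun j => j ∉ G.image (σ t)), ind (rep t) j := by
      simp only [cnt]
      rw [← Finset.sum_filter_add_sum_filter_not univ (fun j => j ∈ G.image (σ t))]
      congr 1
      congr 1; ext j; simp
    have hrest_card : (univ.filter fun j : Fin N => j ∉ G.image (σ t)).card = (E t).card := by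
      have := Finset.card_filter_add_card_filter_not (s := (univ : Finset (Fin N))) (fun j => j ∈ G.image (σ t))
      simp only [Finset.card_univ, Fintype.card_fin] at this
      have h1 : (univ.filter fun j => j ∈ G.image (σ t)) = G.image (σ t) := by ext j; simp
      rw [h1, hcardG] at this
      omega
    -- bounds
    have hA : 0 ≤ ∑ i ∈ E t, ind t i := Finset.sum_nonneg fun i _ => ind_nonneg t i
    have hA' : ∑ i ∈ E t, ind t i ≤ (E t).card := by
      have := Finset.sum_le_sum fun i (_ : i ∈ E t) => ind_le_one t i
      simpa using this
    have hB : 0 ≤ ∑ j ∈ univ.filter (fun j => j ∉ G.image (σ t)), ind (rep t) j := Finset.sum_nonneg fun j _ => ind_nonneg _ j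
    have hB' : ∑ j ∈ univ.filter (fun j => j ∉ G.image (σ t)), ind (rep t) j ≤ (E t).card := by
      have := Finset.sum_le_sum fun j (_ : j ∈ univ.filter (fun j => j ∉ G.image (σ t))) => ind_le_one (rep t) j
      simp only [Finset.sum_const, nsmul_eq_mul, mul_one] at this
      rw [hrest_card] at this
      exact this
    have hEt : ((E t).card : ℚ) ≤ e := by exact_mod_cast hE t
    rw [abs_le]
    have hc : cnt t = ∑ i ∈ E t, ind t i + ∑ i ∈ G, ind t i := hsplit (ind t)
    rw [hc, hG, hsplit']
    constructor <;> linarith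
  -- STEP 4: balance kills Σ_t z t · cnt (rep t); the rest is ≥ -e Σ |z|
  have hbal' : ∑ t, z t * cnt (rep t) = 0 := by
    rw [← Finset.sum_fiberwise univ rep (fun t => z t * cnt (rep t))]
    apply Finset.sum_eq_zero
    intro r _
    have : ∑ t ∈ univ.filter (fun t => rep t = r), z t * cnt (rep t) = (∑ t ∈ univ.filter (fun t => rep t = r), z t) * cnt r := by
      rw [Finset.sum_mul]
      apply Finset.sum_congr rfl; intro t ht
      simp only [mem_filter, mem_univ, true_and] at ht
      rw [ht]
    rw [this, hbal r, zero_mul]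
  have step4 : -((e : ℚ) * ∑ t, |z t|) ≤ ∑ t, z t * cnt t := by
    have hdec : ∑ t, z t * cnt t = ∑ t, z t * (cnt t - cnt (rep t)) + ∑ t, z t * cnt (rep t) := by
      rw [← Finset.sum_add_distrib]; apply Finset.sum_congr rfl; intro t _; ring
    rw [hdec, hbal', add_zero, Finset.mul_sum, ← Finset.sum_neg_distrib]
    apply Finset.sum_le_sum; intro t _
    have h3 := step3 t
    have : |z t * (cnt t - cnt (rep t))| ≤ |z t| * e := by
      rw [abs_mul]; exact mul_le_mul_of_nonneg_left h3 (abs_nonneg _)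
    have h4 := neg_abs_le (z t * (cnt t - cnt (rep t)))
    nlinarith [this, h4, abs_nonneg (z t)]
  -- contradiction with the margin
  nlinarith [step2, step4, hmargin]

end Summit.Ventures.DiscreteObjects.UnitDistance
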